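import Mathlib.AlgebraicGeometry.AffineSpace
import Mathlib.AlgebraicGeometry.Geometrically.Integral
import Literature.AlgebraicGeometry.Motives.FiniteFlatChart
import Literature.AlgebraicGeometry.Motives.AbelianVarietyAmpleProofs
import HarnessLib

/-!
# The family of translates of a divisor along a finite flat chart of an abelian variety, I:
# the incidence scheme `W ×_{𝔸ˢ} (𝔸ˢ × A)` and the action morphism

Setting of Görtz–Wedhorn II, Thm. 27.71, Steps (III)–(IV) (quasi-projectivity of group
varieties; Stacks 0BF7), for an abelian variety `A` over a field `k` and a finite flat chart
`π : W → D(h) ⊆ 𝔸ˢ_k` of `A` (`Motives/FiniteFlatChart`):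

* `ChartFamily.toAffine` — `π` followed by `D(h) ⊆ 𝔸ˢ_k` (Mathlib `𝔸(ι; Spec k)`, `Idx = ULift (Fin s)`),
  a `k`-morphism (`toAffine_over`);
* `ChartFamily.P A c = 𝔸ˢ_A = 𝔸ˢ_k ×_k A` with its projections `prX : P → A`, `prS : P → 𝔸ˢ_k`
  (Mathlib `AffineSpace.map`, a base change of `A → Spec k`: `AffineSpace.isPullback_map`);
* `ChartFamily.WA A c = W ×_{𝔸ˢ_k} P ≅ W ×_k A`, the incidence scheme, with
  `fstW : WA → W` and `ρ : WA → P` ("`π × id_X`"); it is integral (`A` is geometrically integral,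
  Mathlib's instance for pullbacks);
* `ChartFamily.act : WA → A`, `(g, x) ↦ g · x` — the product, in the group `Hom_k(WA, A)` of
  points of the group object `A`, of the two projections (as for `AbelianVariety.translation`);
* `ChartFamily.sectionAt Q : A → WA`, `x ↦ (g, x)` for a rational point `Q` of `A` lying in `W`,
  with `sectionAt Q ≫ act = t_Q` (`sectionAt_act`: the definition of the translation) and
  `sectionAt Q ≫ ρ = s_{π(g)}`, the constant section of `𝔸ˢ_A → A` at the rational point
  `π(g) ∈ 𝔸ˢ(k)` (`sectionAt_ρ`).

Everything is proved; no named facts. Continued in `Motives/AbelianVarietyChartDivisor`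
(the effective Cartier divisor on `𝔸ˢ_A` swept out by the translates of `Supp E`).

## References

* U. Görtz, T. Wedhorn, *Algebraic Geometry II: Cohomology of Schemes*, Springer Spektrum (2023),
  doi:10.1007/978-3-658-43031-3: Thm. 27.71, proof, Steps (III)–(IV), pp. 828–829 (read in the
  held copy). [GortzWedhorn2023]
* The Stacks project, Tag 0BF7. [StacksProject]
-/

universe u

open CategoryTheory CategoryTheory.Limits AlgebraicGeometry TopologicalSpace Opposite
open scoped MonObj

noncomputable section

namespace Literature.AlgebraicGeometry.Motives

namespace ChartFamily

variable {k : Type u} [Field k] (A : AbelianVariety k) (c : FiniteFlatChart k A.X.left A.X.hom)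

/-! ### The chart as a morphism to affine space over `k` -/

/-- The index type of the coordinates (in the universe of the schemes). [folklore] -/
abbrev Idx : Type u := ULift.{u} (Fin c.s)

/-- `k[T_i ; i ∈ ι] ≅ k[T₁, …, T_s]`, renaming along `ULift (Fin s) ≃ Fin s`. [folklore] -/
def renameE : MvPolynomial (Idx A c) k ≃ₐ[k] MvPolynomial (Fin c.s) k :=
  MvPolynomial.renameEquiv k Equiv.ulift

/-- **The open immersion `jS : D(h) = Spec k[T]_h → 𝔸ˢ_k`**: `Spec k[T]_h → Spec k[T] ≅ 𝔸ˢ_k`.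
[folklore] -/
def jS : Spec (.of (Localization.Away c.h)) ⟶ 𝔸(Idx A c; Spec (.of k)) :=
  Spec.map (CommRingCat.ofHom (algebraMap (MvPolynomial (Fin c.s) k) (Localization.Away c.h))) ≫
    Spec.map (CommRingCat.ofHom (renameE A c).toRingEquiv.toRingHom) ≫
      (AffineSpace.SpecIso (Idx A c) (.of k)).inv

/-- `jS` is an open immersion (a localisation followed by isomorphisms). [folklore] -/
instance isOpenImmersion_jS : IsOpenImmersion (jS A c) := by
  haveI : IsOpenImmersion (Spec.map (CommRingCat.ofHom
      (algebraMap (MvPolynomial (Fin c.s) k) (Localization.Away c.h)))) :=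
    IsOpenImmersion.of_isLocalization c.h
  haveI : IsIso (CommRingCat.ofHom (renameE A c).toRingEquiv.toRingHom) :=
    (renameE A c).toRingEquiv.toCommRingCatIso.isIso_hom
  unfold jS; infer_instance

/-- **`π` as a morphism `W → 𝔸ˢ_k`**: `W →π D(h) →jS 𝔸ˢ_k`. [folklore] -/
def toAffine : (c.W : Scheme.{u}) ⟶ 𝔸(Idx A c; Spec (.of k)) := c.π ≫ jS A c

/-- `toAffine` is a `k`-morphism. [folklore] -/
@[reassoc]
theorem toAffine_over : toAffine A c ≫ (𝔸(Idx A c; Spec (.of k)) ↘ Spec (.of k)) = c.W.ι ≫ A.X.hom := by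
  simp only [toAffine, jS, Category.assoc, AffineSpace.SpecIso_inv_over, ← Spec.map_comp]
  rw [← c.π_over]
  congr 2
  rw [← CommRingCat.ofHom_comp, ← CommRingCat.ofHom_comp]
  congr 1
  ext r
  · change algebraMap _ _ ((renameE A c) (MvPolynomial.C r)) = algebraMap k _ r
    rw [← MvPolynomial.algebraMap_eq, AlgEquiv.commutes, IsScalarTower.algebraMap_apply k
      (MvPolynomial (Fin c.s) k) (Localization.Away c.h)]

/-! ### `P = 𝔸ˢ_A` and the incidence scheme `WA = W ×_{𝔸ˢ_k} P` -/

/-- `P = 𝔸ˢ_A`. [folklore] -/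
abbrev P : Scheme.{u} := 𝔸(Idx A c; A.X.left)

/-- `prS : 𝔸ˢ_A → 𝔸ˢ_k` (base change of `A → Spec k`). [folklore] -/
abbrev prS : P A c ⟶ 𝔸(Idx A c; Spec (.of k)) := AffineSpace.map (Idx A c) A.X.hom

/-- **The incidence scheme `WA = W ×_{𝔸ˢ_k} 𝔸ˢ_A`** (`≅ W ×_k A`). [folklore] -/
abbrev WA : Scheme.{u} := pullback (toAffine A c) (prS A c)

/-- `WA → W`. [folklore] -/
abbrev fstW : WA A c ⟶ c.W := pullback.fst (toAffine A c) (prS A c)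

/-- **`ρ = π × id : WA → 𝔸ˢ_A`**, a base change of `toAffine` (finite flat onto `D(h) × A`).
[folklore] -/
abbrev ρ : WA A c ⟶ P A c := pullback.snd (toAffine A c) (prS A c)

/-- `toAffine` is flat (finite flat followed by an open immersion). [folklore] -/
instance flat_toAffine : Flat (toAffine A c) := by
  haveI := c.flat_π; unfold toAffine; infer_instance

/-- `ρ` is flat (a base change of `toAffine`). [folklore] -/
instance flat_ρ : Flat (ρ A c) := inferInstance

/-- **`P_V = D(h) × A ⊆ 𝔸ˢ_A`**, the open part of `P` over `D(h)`, as the fibre product. [folklore] -/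
abbrev PV : Scheme.{u} := pullback (jS A c) (prS A c)

/-- The open immersion `jA : P_V → P`. [folklore] -/
abbrev jA : PV A c ⟶ P A c := pullback.snd (jS A c) (prS A c)

/-- **`ρ₁ : WA → P_V`, the finite flat surjective part of `ρ`** (a base change of `π`).
[folklore] -/
def ρ₁ : WA A c ⟶ PV A c :=
  (pullbackRightPullbackFstIso (jS A c) (prS A c) c.π).inv ≫
    pullback.snd c.π (pullback.fst (jS A c) (prS A c))

/-- `ρ = ρ₁ ≫ jA`. [folklore] -/
@[reassoc]
theorem ρ₁_jA : ρ₁ A c ≫ jA A c = ρ A c := by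
  change ((pullbackRightPullbackFstIso (jS A c) (prS A c) c.π).inv ≫
    pullback.snd c.π (pullback.fst (jS A c) (prS A c))) ≫ pullback.snd (jS A c) (prS A c) =
      pullback.snd (c.π ≫ jS A c) (prS A c)
  rw [Category.assoc, pullbackRightPullbackFstIso_inv_snd_snd]

/-- `ρ₁` is finite. [folklore] -/
instance isFinite_ρ₁ : IsFinite (ρ₁ A c) := by
  haveI := c.isFinite_π; unfold ρ₁; infer_instance

/-- `ρ₁` is flat. [folklore] -/
instance flat_ρ₁ : Flat (ρ₁ A c) := by
  haveI := c.flat_π; unfold ρ₁; infer_instance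

/-- `ρ₁` is surjective. [folklore] -/
instance surjective_ρ₁ : Surjective (ρ₁ A c) := by
  haveI := c.surjective_π; unfold ρ₁; infer_instance

/-- The range of `jA` is `prS⁻¹(D(h))`. [folklore] -/
theorem range_jA : Set.range (jA A c) = (prS A c) ⁻¹' Set.range (jS A c) :=
  Scheme.Pullback.range_snd _ _

/-- `Spec k` has one point. [folklore] -/
theorem subsingleton_Spec : Subsingleton ↥(Spec (CommRingCat.of k)) :=
  inferInstanceAs (Subsingleton (PrimeSpectrum k))

/-- `prS` is geometrically integral (a base change of `A → Spec k`). [folklore] -/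
instance geometricallyIntegral_prS : GeometricallyIntegral (prS A c) :=
  MorphismProperty.of_isPullback (AffineSpace.isPullback_map A.X.hom).flip A.geometricallyIntegral

/-- `prS` is flat. [folklore] -/
instance flat_prS : Flat (prS A c) := by
  haveI := subsingleton_Spec (k := k)
  exact MorphismProperty.of_isPullback (AffineSpace.isPullback_map A.X.hom).flip inferInstance

/-- `prS` is universally open. [folklore] -/
instance universallyOpen_prS : UniversallyOpen (prS A c) := by
  haveI := subsingleton_Spec (k := k)
  haveI : LocallyOfFinitePresentation A.X.hom := by
    haveI := A.smooth_hom; infer_instance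
  exact MorphismProperty.of_isPullback (AffineSpace.isPullback_map A.X.hom).flip inferInstance

/-- `prS` is surjective. [folklore] -/
instance surjective_prS : Surjective (prS A c) := inferInstance

/-- `W` is non-empty. [folklore] -/
instance nonempty_W : Nonempty c.W := c.nonempty_W

/-- `W` is locally noetherian. [folklore] -/
instance isLocallyNoetherian_W : IsLocallyNoetherian (c.W : Scheme.{u}) := by
  haveI := A.isNoetherian_left
  infer_instance

/-- **`WA` is integral** (`A → Spec k` is geometrically integral, flat and universally open;
Mathlib's instance for pullbacks). [folklore] -/
instance isIntegral_WA : IsIntegral (WA A c) := inferInstance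

/-! ### `WA` as a `k`-scheme and the action morphism -/

/-- `WA` as a `k`-scheme, through `ρ`, `prX` and `A → Spec k`. [folklore] -/
abbrev WAo : SchemeOver k := Over.mk (ρ A c ≫ (P A c ↘ A.X.left) ≫ A.X.hom)

/-- The `g`-component `WA → W ⊆ A`, a `k`-morphism. [folklore] -/
def gComp : WAo A c ⟶ A.X :=
  Over.homMk (fstW A c ≫ c.W.ι) (by
    change (fstW A c ≫ c.W.ι) ≫ A.X.hom = ρ A c ≫ (P A c ↘ A.X.left) ≫ A.X.hom
    rw [Category.assoc, ← toAffine_over, ← Category.assoc, pullback.condition, Category.assoc,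
      AffineSpace.map_over])

/-- The `x`-component `WA → 𝔸ˢ_A → A`, a `k`-morphism. [folklore] -/
def xComp : WAo A c ⟶ A.X :=
  Over.homMk (ρ A c ≫ (P A c ↘ A.X.left)) (by rfl)

/-- **The action morphism `act : WA → A`, `(g, x) ↦ g · x`**: the product of the two components
in the group `Hom_k(WA, A)` (Görtz–Wedhorn II, (27.1): the group law on `T`-valued points).
[cite: GortzWedhorn2023, Def. 27.1 (p. 799)] -/
def act : WAo A c ⟶ A.X := gComp A c * xComp A c

/-- The underlying morphism of the `g`-component. [folklore] -/
@[simp] theorem gComp_left : (gComp A c).left = fstW A c ≫ c.W.ι := rfl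

/-- The underlying morphism of the `x`-component. [folklore] -/
@[simp] theorem xComp_left : (xComp A c).left = ρ A c ≫ (P A c ↘ A.X.left) := rfl

/-! ### Sections of `WA → A` at rational points of `W` -/

section Sections

variable {A c} (Q : A.Points k) (hQ : AlgPoints.pt Q ∈ c.W)

/-- The rational point `Q ∈ W(k)` as a morphism `Spec k → W`. [folklore] -/
def ptW : Spec (.of k) ⟶ (c.W : Scheme.{u}) :=
  IsOpenImmersion.lift c.W.ι Q.left (by
    rintro _ ⟨p, rfl⟩
    haveI := subsingleton_Spec (k := k)
    have : p = IsLocalRing.closedPoint k := Subsingleton.elim _ _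
    rw [this, Scheme.Opens.range_ι]
    exact hQ)

/-- `ptW` followed by `W ⊆ A` is the rational point. [folklore] -/
@[reassoc (attr := simp)]
theorem ptW_ι : ptW Q hQ ≫ c.W.ι = Q.left := IsOpenImmersion.lift_fac _ _ _

/-- The rational point `v = π(Q) ∈ 𝔸ˢ(k)`. [folklore] -/
def vpt : Spec (.of k) ⟶ 𝔸(Idx A c; Spec (.of k)) := ptW Q hQ ≫ toAffine A c

/-- **The constant section `s_v : A → 𝔸ˢ_A` at `v = π(Q)`** (`x ↦ (v, x)`). [folklore] -/
def sv : A.X.left ⟶ P A c :=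
  (AffineSpace.isPullback_map (n := Idx A c) A.X.hom).lift (A.X.hom ≫ vpt Q hQ) (𝟙 _) (by
    rw [Category.id_comp, Category.assoc, vpt, Category.assoc, toAffine_over, ptW_ι_assoc]
    have hQ1 : Q.left ≫ A.X.hom = 𝟙 (Spec (.of k)) := by
      have := Over.w Q
      simpa only [Over.mk_hom, Algebra.algebraMap_self, CommRingCat.ofHom_id, Spec.map_id] using this
    change A.X.hom ≫ Q.left ≫ A.X.hom = A.X.hom
    erw [hQ1]
    exact Category.comp_id _)

/-- `s_v ≫ prS` is the constant morphism at `v`. [folklore] -/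
@[reassoc (attr := simp)]
theorem sv_prS : sv Q hQ ≫ prS A c = A.X.hom ≫ vpt Q hQ := IsPullback.lift_fst _ _ _ _

/-- `s_v` is a section of `𝔸ˢ_A → A`. [folklore] -/
@[reassoc (attr := simp)]
theorem sv_over : sv Q hQ ≫ (P A c ↘ A.X.left) = 𝟙 _ := IsPullback.lift_snd _ _ _ _

/-- **The section `sectionAt Q : A → WA`, `x ↦ (g, x)`** at the rational point `Q = g ∈ W(k)`.
[folklore] -/
def sectionAt : A.X.left ⟶ WA A c :=
  pullback.lift (A.X.hom ≫ ptW Q hQ) (sv Q hQ) (by rw [sv_prS, Category.assoc]; rfl)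

/-- `sectionAt Q ≫ fstW` is constant at `g`. [folklore] -/
@[reassoc (attr := simp)]
theorem sectionAt_fstW : sectionAt Q hQ ≫ fstW A c = A.X.hom ≫ ptW Q hQ := pullback.lift_fst _ _ _

/-- `sectionAt Q ≫ ρ = s_v`. [folklore] -/
@[reassoc (attr := simp)]
theorem sectionAt_ρ : sectionAt Q hQ ≫ ρ A c = sv Q hQ := pullback.lift_snd _ _ _

/-- `sectionAt Q` as a `k`-morphism `A → WA`. [folklore] -/
def sectionAtOver : A.X ⟶ WAo A c :=
  Over.homMk (sectionAt Q hQ) (by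
    change sectionAt Q hQ ≫ ρ A c ≫ (P A c ↘ A.X.left) ≫ A.X.hom = A.X.hom
    rw [sectionAt_ρ_assoc, sv_over_assoc])

/-- The `g`-component of the section is the constant point `Q`. [folklore] -/
theorem sectionAtOver_gComp : sectionAtOver Q hQ ≫ gComp A c = toSpecOver A.X ≫ Q := by
  ext1
  change sectionAt Q hQ ≫ fstW A c ≫ c.W.ι = A.X.hom ≫ Q.left
  rw [sectionAt_fstW_assoc, ptW_ι]

/-- The `x`-component of the section is the identity. [folklore] -/
theorem sectionAtOver_xComp : sectionAtOver Q hQ ≫ xComp A c = 𝟙 A.X := by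
  ext1
  change sectionAt Q hQ ≫ ρ A c ≫ (P A c ↘ A.X.left) = 𝟙 A.X.left
  rw [sectionAt_ρ_assoc, sv_over]

/-- **`act ∘ sectionAt Q = t_Q`**: the action restricted to the slice `{g} × A` is the
translation by `g` (both are the product of the constant map at `Q` with the identity in
`Hom_k(A, A)`). [cite: GortzWedhorn2023, Def. 27.1 (p. 799)] -/
theorem sectionAtOver_act : sectionAtOver Q hQ ≫ act A c = A.translation Q := by
  rw [act, MonObj.comp_mul, sectionAtOver_gComp, sectionAtOver_xComp]
  rfl

/-- The same on underlying schemes: `sectionAt Q ≫ act = t_Q`. [folklore] -/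
theorem sectionAt_act : sectionAt Q hQ ≫ (act A c).left = (A.translation Q).left :=
  congrArg CommaMorphism.left (sectionAtOver_act Q hQ)

end Sections

end ChartFamily

end Literature.AlgebraicGeometry.Motives

end
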